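import Literature.NumberTheory.Sieve.LargestPrimeFactorCubicTcountMoebius
import Literature.NumberTheory.Sieve.LargestPrimeFactorCubicRootPairs
import HarnessLib

/-!
# Heath-Brown 2001 (PLMS), §7 p. 29: for `(a,b) = 1` the divisors `r ∣ a³ − 2b³` correspond to the
# pairs `(r, k)`, `k³ ≡ 2`, `r ∣ a − bk` — so `C′(r) = ∑_{k} T(r,k)`

Topic `Literature/NumberTheory/Sieve`; a PROVED arithmetic layer (one definition with body, no named
facts) under the named fact `Irving2015_largestPrimeFactor_cubic` (`LargestPrimeFactorCubic.lean`), an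
input of Heath-Brown's **Lemma 7**.  Source: D. R. Heath-Brown, *The largest prime factor of `X³ + 2`*,
Proc. London Math. Soc. (3) 82 (2001) 554–596, §7 p. 29: "It is an easy exercise to verify that, if
`(a, b) = 1`, then there is a 1-1 correspondence between divisors `r` of `a³ − 2b³` and ideal divisors
`R` of `a − b∛2`, given by `r → (r, a − b∛2) = R` and `R → N(R) = r`" — whence (7.15) becomes a sum of
the `T(R)` of Lemma 11, `C′(r) = #{a, b : … (a,b) = 1, r ∣ q}` (p. 27).  In root language the ideal
`R = (r, a − b∛2)` with `ρ(R) = 1` is the pair `(r, k)` with `k ≡ a b⁻¹ (mod r)`: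

* `existsUnique_root_of_coprime` — for `(a, b) = 1`, `r ≥ 1`, `r ∣ a³ − 2b³`: there is exactly one
  `k ∈ rootsCube r` with `r ∣ a − bk`; `dvd_cube_of_root` — conversely `r ∣ a − bk`, `k³ ≡ 2 ⇒ r ∣ a³ − 2b³`;
* `card_rootsCube_filter_eq` — `#{k ∈ rootsCube r : r ∣ a − bk} = [r ∣ a³ − 2b³]` for `(a,b) = 1`;
* `Cprime r A B M = #{(a,b) ∈ (A,A+M]×(B,B+M] : (a,b) = 1, r ∣ a³ − 2b³}` and
  **`Cprime_eq_sum_Tcount`** — `C′(r) = ∑_{k ∈ rootsCube r} T(r, k; A, B, M)` (`r ≥ 1`).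

## References

* D. R. Heath-Brown, *The largest prime factor of `X³ + 2`*, Proc. London Math. Soc. (3) 82 (2001)
  554–596, §7 p. 27 (`C′`), p. 29. [`HeathBrown2001LargestPrimeFactorCubic`]

## Mathlib / tree search

Tree: `rootsCube`, `mem_rootsCube`, `dvd_cube_sub_two_mul_cube` (`…RootPairs`), `Tcount` (`…TcountMoebius`).
Mathlib: `Nat.Coprime`, `Int.isCoprime_iff_gcd_eq_one`, `IsCoprime.pow_left`, `Int.emod_emod_of_dvd`,
`Finset.card_eq_one`, `Finset.sum_comm`, `Finset.card_eq_sum_card_fiberwise`.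
-/

noncomputable section

open Finset

namespace Literature.NumberTheory.Sieve.HeathBrown2001

/-! ### Roots from coprime pairs -/

/-- `r ∣ a − bk` and `r ∣ k³ − 2` give `r ∣ a³ − 2b³`. [cite: HeathBrown2001LargestPrimeFactorCubic, §7 p. 29] -/
theorem dvd_cube_of_root {r k a b : ℤ} (hk : r ∣ k ^ 3 - 2) (h : r ∣ a - b * k) : r ∣ a ^ 3 - 2 * b ^ 3 := by
  have := dvd_cube_sub_two_mul_cube hk (ν := b) (d := a) (by rw [← dvd_neg, neg_sub]; exact h)
  exact this

/-- For `(a, b) = 1` and `r ∣ a³ − 2b³`, `b` is invertible modulo `r`. [folklore] -/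
theorem isCoprime_b_of_dvd {r : ℕ} {a b : ℕ} (hab : Nat.Coprime a b) (hr : (r : ℤ) ∣ (a : ℤ) ^ 3 - 2 * (b : ℤ) ^ 3) :
    IsCoprime (b : ℤ) (r : ℤ) := by
  -- a common prime of `b` and `r` divides `a³`, hence `a`
  have hab' : IsCoprime ((a : ℤ) ^ 3) (b : ℤ) :=
    (Nat.isCoprime_iff_coprime.mpr hab).pow_left
  -- `IsCoprime b (a³ − 2b³ ) ⇒ IsCoprime b r`? We show `IsCoprime b (a^3)` transfers along `r ∣ a³ − 2b³`.
  have h1 : IsCoprime (b : ℤ) ((a : ℤ) ^ 3 - 2 * (b : ℤ) ^ 3) := by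
    have : IsCoprime (b : ℤ) ((a : ℤ) ^ 3) := hab'.symm
    have h2 : (a : ℤ) ^ 3 - 2 * (b : ℤ) ^ 3 = (a : ℤ) ^ 3 + (b : ℤ) * (-2 * (b : ℤ) ^ 2) := by ring
    rw [h2]
    exact this.add_mul_left_right _
  exact h1.of_isCoprime_of_dvd_right hr

/-- **Exactly one root class**: for `(a,b) = 1`, `r ≥ 1` and `r ∣ a³ − 2b³` there is a unique
`k ∈ rootsCube r` with `r ∣ a − bk` (namely `k ≡ a b⁻¹`). [cite: HeathBrown2001LargestPrimeFactorCubic, §7 p. 29] -/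
theorem card_rootsCube_filter_eq_one {r a b : ℕ} (hr : 0 < r) (hab : Nat.Coprime a b)
    (hdvd : (r : ℤ) ∣ (a : ℤ) ^ 3 - 2 * (b : ℤ) ^ 3) :
    #((rootsCube r).filter fun k : ℕ => (r : ℤ) ∣ (a : ℤ) - b * k) = 1 := by
  obtain ⟨u, v, huv⟩ := isCoprime_b_of_dvd hab hdvd
  -- `u b + v r = 1`; the root is `k₀ = (a u) mod r`
  have hr' : (0 : ℤ) < r := by exact_mod_cast hr
  set k₀ : ℕ := ((a : ℤ) * u % r).toNat with hk₀
  have hk₀Z : (k₀ : ℤ) = (a : ℤ) * u % r := by rw [hk₀, Int.toNat_of_nonneg (Int.emod_nonneg _ hr'.ne')]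
  have hk₀lt : k₀ < r := by
    have : ((a : ℤ) * u % r) < r := Int.emod_lt_of_pos _ hr'
    omega
  have hcong : (r : ℤ) ∣ (a : ℤ) * u - k₀ := by rw [hk₀Z]; exact Int.dvd_self_sub_emod
  -- `r ∣ a − b k₀`: `a − b k₀ ≡ a − b a u = a (1 − b u) = a v r`
  have hroot_lin : (r : ℤ) ∣ (a : ℤ) - b * k₀ := by
    have e : (a : ℤ) - b * k₀ = (b : ℤ) * ((a : ℤ) * u - k₀) + a * (v * r) + a * (1 - (u * b + v * r)) := by ring
    rw [e, huv, sub_self, mul_zero, add_zero]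
    exact dvd_add (dvd_mul_of_dvd_right hcong _) (dvd_mul_of_dvd_right (dvd_mul_left _ _) _)
  -- `k₀³ ≡ 2`: from `b k₀ ≡ a`, `b³ k₀³ ≡ a³ ≡ 2 b³`, and `b` invertible
  have hroot : (r : ℤ) ∣ (k₀ : ℤ) ^ 3 - 2 := by
    have h1 : (r : ℤ) ∣ (b : ℤ) ^ 3 * ((k₀ : ℤ) ^ 3 - 2) := by
      have e : (b : ℤ) ^ 3 * ((k₀ : ℤ) ^ 3 - 2) =
          -(((a : ℤ) - b * k₀) * ((a : ℤ) ^ 2 + a * (b * k₀) + (b * (k₀ : ℤ)) ^ 2)) + ((a : ℤ) ^ 3 - 2 * (b : ℤ) ^ 3) := by ring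
      rw [e]
      exact dvd_add (dvd_neg.mpr (dvd_mul_of_dvd_left hroot_lin _)) hdvd
    have hcop : IsCoprime ((b : ℤ) ^ 3) (r : ℤ) := (isCoprime_b_of_dvd hab hdvd).pow_left
    exact hcop.symm.dvd_of_dvd_mul_left h1
  rw [card_eq_one]
  refine ⟨k₀, ?_⟩
  ext k
  rw [mem_filter, mem_rootsCube, mem_singleton]
  constructor
  · rintro ⟨⟨hklt, -⟩, hk⟩
    -- `b k ≡ a ≡ b k₀` so `k ≡ k₀`, both `< r`
    have h1 : (r : ℤ) ∣ (b : ℤ) * ((k : ℤ) - k₀) := by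
      have := dvd_sub hroot_lin hk
      rw [show (a : ℤ) - b * k₀ - ((a : ℤ) - b * k) = (b : ℤ) * ((k : ℤ) - k₀) by ring] at this
      exact this
    have h2 : (r : ℤ) ∣ (k : ℤ) - k₀ := (isCoprime_b_of_dvd hab hdvd).symm.dvd_of_dvd_mul_left h1
    have h3 : |(k : ℤ) - k₀| < r := by
      rw [abs_lt]; constructor <;> omega
    have h4 : (k : ℤ) - k₀ = 0 := by
      by_contra hne
      have := Int.le_of_dvd (abs_pos.mpr hne) ((dvd_abs _ _).mpr h2)
      omega
    omega
  · rintro rfl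
    exact ⟨⟨hk₀lt, hroot⟩, hroot_lin⟩

/-- **`#{k ∈ rootsCube r : r ∣ a − bk} = [r ∣ a³ − 2b³]`** for `(a, b) = 1`, `r ≥ 1`.
[cite: HeathBrown2001LargestPrimeFactorCubic, §7 p. 29] -/
theorem card_rootsCube_filter_eq {r a b : ℕ} (hr : 0 < r) (hab : Nat.Coprime a b) :
    #((rootsCube r).filter fun k : ℕ => (r : ℤ) ∣ (a : ℤ) - b * k) =
      if (r : ℤ) ∣ (a : ℤ) ^ 3 - 2 * (b : ℤ) ^ 3 then 1 else 0 := by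
  split_ifs with h
  · exact card_rootsCube_filter_eq_one hr hab h
  · rw [card_eq_zero, filter_eq_empty_iff]
    intro k hk hlin
    exact h (dvd_cube_of_root (mem_rootsCube.mp hk).2 hlin)

/-! ### `C′(r) = ∑_k T(r, k)` -/

/-- `C′(r) = #{(a,b) ∈ (A,A+M]×(B,B+M] : (a,b) = 1, r ∣ a³ − 2b³}`. [cite: HeathBrown2001LargestPrimeFactorCubic, §7 p. 27 (C′)] -/
def Cprime (r A B M : ℕ) : ℕ :=
  #((Ioc A (A + M) ×ˢ Ioc B (B + M)).filter fun ab : ℕ × ℕ =>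
    Nat.Coprime ab.1 ab.2 ∧ (r : ℤ) ∣ (ab.1 : ℤ) ^ 3 - 2 * (ab.2 : ℤ) ^ 3)

/-- **`C′(r) = ∑_{k ∈ rootsCube r} T(r, k; A, B, M)`** (`r ≥ 1`). [cite: HeathBrown2001LargestPrimeFactorCubic, §7 p. 29 (1-1 correspondence r ↔ R)] -/
theorem Cprime_eq_sum_Tcount {r : ℕ} (hr : 0 < r) (A B M : ℕ) :
    Cprime r A B M = ∑ k ∈ rootsCube r, Tcount r k A B M := by
  classical
  set box := Ioc A (A + M) ×ˢ Ioc B (B + M) with hbox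
  -- both sides count pairs `(ab, k)`; rewrite each as a double sum of indicators
  have lhs : Cprime r A B M = ∑ ab ∈ box.filter (fun ab : ℕ × ℕ => Nat.Coprime ab.1 ab.2),
      #((rootsCube r).filter fun k : ℕ => (r : ℤ) ∣ (ab.1 : ℤ) - ab.2 * k) := by
    rw [Cprime, ← hbox]
    rw [show (box.filter fun ab : ℕ × ℕ => Nat.Coprime ab.1 ab.2 ∧ (r : ℤ) ∣ (ab.1 : ℤ) ^ 3 - 2 * (ab.2 : ℤ) ^ 3) =
        (box.filter fun ab : ℕ × ℕ => Nat.Coprime ab.1 ab.2).filter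
          (fun ab : ℕ × ℕ => (r : ℤ) ∣ (ab.1 : ℤ) ^ 3 - 2 * (ab.2 : ℤ) ^ 3) by rw [filter_filter]]
    rw [card_filter]
    refine sum_congr rfl fun ab hab => ?_
    rw [mem_filter] at hab
    rw [card_rootsCube_filter_eq hr hab.2]
  have rhs : ∑ k ∈ rootsCube r, Tcount r k A B M =
      ∑ k ∈ rootsCube r, ∑ ab ∈ box.filter (fun ab : ℕ × ℕ => Nat.Coprime ab.1 ab.2),
        if (r : ℤ) ∣ (ab.1 : ℤ) - ab.2 * k then 1 else 0 := by
    refine sum_congr rfl fun k _ => ?_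
    rw [Tcount, ← hbox]
    rw [show (box.filter fun ab : ℕ × ℕ => Nat.Coprime ab.1 ab.2 ∧ (r : ℤ) ∣ (ab.1 : ℤ) - ab.2 * k) =
        (box.filter fun ab : ℕ × ℕ => Nat.Coprime ab.1 ab.2).filter
          (fun ab : ℕ × ℕ => (r : ℤ) ∣ (ab.1 : ℤ) - ab.2 * k) by rw [filter_filter]]
    rw [card_filter]
  rw [lhs, rhs, sum_comm]
  refine sum_congr rfl fun ab _ => ?_
  rw [card_filter]

end Literature.NumberTheory.Sieve.HeathBrown2001
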